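import Summits.BirchSwinnertonDyer.BirchSwinnertonDyer.Theorems.Rank2Observatory2DescClKillCurveCertSDefs
import Summits.BirchSwinnertonDyer.BirchSwinnertonDyer.Theorems.Rank2Observatory2DescClCurveCertSMain
import Summits.BirchSwinnertonDyer.BirchSwinnertonDyer.Theorems.Rank2Observatory2DescClRowCertLe
import HarnessLib

/-!
# BirchSwinnertonDyer — rank ≥ 2 observatory: KERNEL-2DESC-CL v3.0, SK — the SPLIT-2 per-curve certificate WITH A KILL LIST (complex case), part 2/3: soundness

HONEST FRAMING: per-curve certified theorems and census instruments; no claim on BSD in rank ≥ 2.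

Part 2 of 3.  **Soundness of the split-2 kill-list checker** `rank_le_of_checkSK`: the proof of
`rank_le_of_checkS` (`Rank2Observatory2DescClCurveCertSMain`) verbatim up to the sieve; then, for a class `(∅, U)`
met by a rational point, `(x − e)·∏_{j∈U} x_j ∈ (K×)²` is rescaled by the SQUARE `m₁^{#U+1} = (r₁^{#U+1})²` to
`(m₁x − X_t(θ))·∏_{j∈U} X_j(θ) ∈ (K×)²`, which the landed `admKills_sound` (`Rank2Observatory2DescKillList`) excludes
for every listed class given the list certificate (`killListCheck_of_searchS`, part 1); the strict-count cover theorem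
`mordellWeilRank_le_of_coverSet_cl_lt` (`Rank2Observatory2DescClRowCertLe`) then gives `rank E(ℚ) ≤ r` from FEWER THAN
`2^(r+1)` surviving classes.  `rank_eq_of_checkSK` adds the tree's lower bound.  The `K`-free row shapes are in
`Rank2Observatory2DescClKillCurveCertSRows`.  Text = the v2.7 kill tail (`Rank2Observatory2DescClKillCurveCertE2`)
on the split-2 records.  New declarations only; nothing landed is touched.  Sorry-free; axioms `propext`,
`Classical.choice`, `Quot.sound`.
[cite: Cassels1991LecturesEllipticCurves, §15] [cite: CremonaAlgorithms1997, §3.6] [cite: Cohen1993, §4.8.2, §6.2, §6.5]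
[cite: SilvermanAEC2009, X.1.1]
-/

set_option linter.dupNamespace false

noncomputable section

open scoped Classical NumberField nonZeroDivisors

open Literature.NumberTheory.NumberFields Polynomial Module NumberField IsDedekindDomain Ideal

namespace Summit.BirchSwinnertonDyer.BirchSwinnertonDyer.Rank2Observatory.TwoDescCl

open TwoDescCubic ClFieldCert TwoDescKill

/-! ## Soundness -/

section Sound

variable {K : Type*} [Field K] [NumberField K] {θ : K}

/-- **Soundness of the split-2 kill-list checker: `rank E(ℚ) ≤ r`** (the proof of `rank_le_of_checkS` up to the
sieve; then the killed classes by `admKills_sound` after rescaling by the square `m₁ ^ (#U + 1)`; then the strict-count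
cover theorem with the sieve `admKills (admS F cc) kills`). [cite: Cassels1991LecturesEllipticCurves, §15] -/
theorem rank_le_of_checkSK (r : ℕ) (F : ClFieldCertS2)
    (hθ : aeval θ (MonicCubic.poly F.fs.base.a F.fs.base.b F.fs.base.c) = 0) (h3 : finrank ℚ K = 3)
    (h2 : F.check2 = true) (hpr : F.fs.base.primeList.Forall Nat.Prime) (cc : ClCurveCertS) (ks : List ClKillS)
    (hc : checkSK F cc r ks = true) (hk : killSearchS F cc ks = true) :
    ((⟨0, cc.A, 0, cc.B, cc.C⟩ : WeierstrassCurve ℚ)).mordellWeilRank ≤ r := by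
  classical
  have hK := F.const_of_check2 h2
  have hS := F.coreS_of_check2 h2
  have hfd := F.field_of_check2 h2
  have hR := F.fs.checkReg_of_coreS hS
  have hirr := F.fs.base.irreducible_of_reg hR
  have h0 := (F.fs.base.interval_of_field hfd).1
  have hq := F.fs.base.q_prime hpr
  simp only [checkSK, Bool.and_eq_true, decide_eq_true_eq, List.all_eq_true] at hc
  obtain ⟨⟨⟨⟨⟨⟨⟨⟨⟨⟨⟨⟨⟨⟨⟨⟨⟨⟨hΔ, hirrF⟩, hcub⟩, hder⟩, htX⟩, htD⟩, hdisc⟩, hND0⟩, hdn⟩, hdnC⟩, hcodes⟩, hdW1⟩,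
    hdW2⟩, hQ⟩, hhead⟩, hfamAll⟩, hcert⟩, hlite⟩, hcount⟩ := hc
  haveI hEl := isElliptic_of_deltaShort_ne hΔ
  have hirrF' := irreducible_of_noRootMod hirrF
  have hm₁K : (F.m₁ : K) ≠ 0 := m₁S_ne_zero_K hK
  have hm₁O : (F.m₁ : 𝓞 K) ≠ 0 := m₁S_ne_zero_O hK
  -- `θ_E = e₀`, root of `F`
  set eT : 𝓞 K := (fracOf F cc.Xt cc.tsnT).toInt hθ htX with heT
  set eD : 𝓞 K := (fracOf F cc.XD cc.tsnD).toInt hθ htD with heD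
  have hXe := m₁_mul_eltS_coe hθ htX
  have haevX := aeval_lin_eq_zero_of_coords hθ cc.Xt hcub
  have haev : aeval (algebraMap (𝓞 K) K eT) (MonicCubic.poly cc.A cc.B cc.C) = 0 := by
    rw [← hXe] at haevX
    simp only [MonicCubic.poly, map_add, map_mul, map_pow, aeval_X, eq_intCast, map_intCast, map_natCast]
      at haevX ⊢
    have h3' : (F.m₁ : K) ^ 3 ≠ 0 := pow_ne_zero 3 hm₁K
    apply mul_right_injective₀ h3'
    simp only [mul_zero]
    linear_combination haevX
  -- `D₀ = F′(e₀)`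
  have hderX := deriv_eq_of_coords hθ cc.Xt (smulCoords (F.m₁ : ℤ) cc.XD) [] hder
  have hderiv : (3 : 𝓞 K) * eT ^ 2 + 2 * ((cc.A : ℤ) : 𝓞 K) * eT + ((cc.B : ℤ) : 𝓞 K) = eD := by
    rw [lin_smulCoords, ← m₁_mul_eltS hθ htX, ← m₁_mul_eltS hθ htD] at hderX
    simp only [List.map_nil, List.prod_nil, mul_one, Int.cast_mul, Int.cast_pow, Int.cast_natCast] at hderX
    have h2' : (F.m₁ : 𝓞 K) ^ 2 ≠ 0 := pow_ne_zero 2 hm₁O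
    apply mul_right_injective₀ h2'
    simp only
    linear_combination hderX
  have hD0 : eD ≠ 0 := eltS_ne_zero hθ h3 hS htD hND0
  have hq0 : ((F.fs.base.q : ℕ) : 𝓞 K) ≠ 0 := by exact_mod_cast hq.ne_zero
  have hM0 : eD * ((F.fs.base.q : ℕ) : 𝓞 K) ≠ 0 := mul_ne_zero hD0 hq0
  have hgen := closure_tsupp_eq_top_of_dvd
    (dvd_mul_left ((F.fs.base.q : ℕ) : 𝓞 K) eD) (F.fs.closure_q_eq_top_of_coreS hθ h3 hS hpr)
  have hDM : ∀ v : HeightOneSpectrum (𝓞 K), (3 : 𝓞 K) * eT ^ 2 + 2 * ((cc.A : ℤ) : 𝓞 K) * eT +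
      ((cc.B : ℤ) : 𝓞 K) ∈ v.asIdeal → eD * ((F.fs.base.q : ℕ) : 𝓞 K) ∈ v.asIdeal := by
    intro v hv
    rw [hderiv] at hv
    exact Ideal.mul_mem_right _ _ hv
  -- `D₀ ∉ W₁, W₂` (read on `X_D`)
  have hXD_W₁ : lin hθ cc.XD.1 cc.XD.2.1 cc.XD.2.2 ∉ (F.fs.base.W₁r hθ h3 hR hpr).asIdeal :=
    lin_not_mem_of_invCert hθ _ (W₁r_asIdeal hθ h3 hR hpr) hdW1
  have hXD_W₂ : lin hθ cc.XD.1 cc.XD.2.1 cc.XD.2.2 ∉ (F.fs.base.W₂r hθ h3 hR hpr).asIdeal :=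
    lin_not_mem_of_invCert hθ _ (W₂r_asIdeal hθ h3 hR hpr) hdW2
  have hDW₁ : eD ∉ (F.fs.base.W₁r hθ h3 hR hpr).asIdeal := fun h =>
    hXD_W₁ (by rw [← m₁_mul_eltS hθ htD]; exact Ideal.mul_mem_left _ _ h)
  have hDW₂ : eD ∉ (F.fs.base.W₂r hθ h3 hR hpr).asIdeal := fun h =>
    hXD_W₂ (by rw [← m₁_mul_eltS hθ htD]; exact Ideal.mul_mem_left _ _ h)
  -- the support `T = {W₁, W₂} ∪ code primes`
  set L := cc.codes.length with hL
  let Tf : Fin (L + 2) → HeightOneSpectrum (𝓞 K) := Matrix.vecCons (F.fs.base.W₁r hθ h3 hR hpr)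
    (Matrix.vecCons (F.fs.base.W₂r hθ h3 hR hpr) fun i => codePrimeS F hθ h3 hS hpr (cc.codes.get i))
  have hT : ∀ w : HeightOneSpectrum (𝓞 K), eD * ((F.fs.base.q : ℕ) : 𝓞 K) ∈ w.asIdeal → ∃ i, Tf i = w := by
    intro w hw
    have hqw : ((F.fs.base.q : ℕ) : 𝓞 K) ∈ w.asIdeal → ∃ i, Tf i = w := fun hqw => by
      rcases eq_W₁r_or_W₂r hθ h3 hR hpr w hqw with rfl | rfl
      · exact ⟨0, by simp [Tf]⟩
      · exact ⟨1, by simp [Tf]⟩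
    rcases w.isPrime.mem_or_mem hw with hD | hq'
    · have hXv : lin hθ cc.XD.1 cc.XD.2.1 cc.XD.2.2 ∈ w.asIdeal := by
        rw [← m₁_mul_eltS hθ htD]; exact Ideal.mul_mem_left _ _ hD
      obtain ⟨pe, hpe, hpv⟩ := exists_prime_of_memS hθ h3 hS hND0 hdn w hXv
      rcases dispatch_soundS (cc := cc) hθ h3 hS hK hpr htD (m₁_mul_eltS hθ htD) (hdnC pe hpe) w hpv hD with
        hq'' | ⟨C, hmem, hany, hC, hw', -⟩ | ⟨i, hmem, hw'⟩
      · exact hqw hq''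
      · obtain ⟨bc, hbc, hbc1⟩ := List.mem_map.mp hmem
        obtain ⟨i, hi⟩ := List.mem_iff_get.mp hbc
        refine ⟨i.succ.succ, HeightOneSpectrum.ext ?_⟩
        simp only [Tf, Matrix.cons_val_succ]
        rw [hi, codePrimeS, if_pos (by rw [hbc1]), show bc.1.2 = C by rw [hbc1],
          codePrimeR_asIdeal hθ h3 hR hpr hany hC, hw']
      · obtain ⟨bc, hbc, hbc1⟩ := List.mem_map.mp hmem
        obtain ⟨i₀, hi₀⟩ := List.mem_iff_get.mp hbc
        refine ⟨i₀.succ.succ, ?_⟩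
        simp only [Tf, Matrix.cons_val_succ]
        rw [hi₀, hw']
        have hb1 : bc.1.1 = false := by rw [hbc1]
        have hb2 : bc.1.2.1 = (i : ℕ) := by rw [hbc1]
        unfold codePrimeS
        rw [if_neg (by rw [hb1]; exact Bool.false_ne_true), dif_pos (by rw [hb2]; exact i.isLt)]
        congr 1
        exact Fin.ext hb2
    · exact hqw hq'
  -- the family
  set fm := famS cc with hfm
  have hfam : ∀ j : Fin fm.length, famCheckS F cc (fm.get j) = true := fun j => hfamAll _ (List.get_mem _ j)
  let W : Fin fm.length → 𝓞 K := fun j =>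
    (fracOf F (fm.get j).X (fm.get j).tsn).toInt hθ (frac_of_famCheckS (hfam j))
  have hW0 : ∀ j, W j ≠ 0 := fun j => eltS_ne_zero hθ h3 hS _ (normFormZ_ne_of_famCheckS (hfam j))
  have hWval : ∀ j (v : HeightOneSpectrum (𝓞 K)), eD * ((F.fs.base.q : ℕ) : 𝓞 K) ∉ v.asIdeal →
      v.valuation K (algebraMap (𝓞 K) K (W j)) = 1 :=
    fun j v hv => valuation_eq_one_of_support _ _ (supp_of_famCheckS hθ h3 hS hK hpr hcodes htD (hfam j)) v hv
  obtain ⟨ρ, hlo, hhi⟩ := F.fs.base.exists_rho_of_field hθ h3 hfd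
  -- independence modulo squares: the parity certificate (rows computed on `X = m₁ x`, `m₁` a square)
  have hind : ∀ S : Finset (Fin fm.length), IsSquare (∏ i ∈ S, algebraMap (𝓞 K) K (W i)) → S = ∅ := by
    intro S hSq
    refine indep_of_parity_certificate (fun i => algebraMap (𝓞 K) K (W i)) (bitS F cc) ?_ hcert S hSq
    intro k S' hS'
    have hS'' : IsSquare (∏ i ∈ S', W i) := isSquare_prod_of_isSquare_prod_coe _ hS'
    obtain ⟨k, hk⟩ := k
    rcases k with _ | _ | _ | k
    · have h := even_card_of_isSquare_real ρ (fun i => algebraMap (𝓞 K) K (W i))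
        (fun i => rho_ne_zero_of_famCheckS hθ ρ hlo hhi h0 (hfam i)) hS'
      convert h using 2
      refine Finset.filter_congr (fun i _ => ?_)
      exact sign_iff_of_famCheckS hθ ρ hlo hhi h0 hK (hfam i)
    · exact even_card_of_isSquare_valuation (F.fs.base.W₁r hθ h3 hR hpr) W hW0 _
        (fun i => by
          show ((!decide ((2 : ℤ) ∣ famL₁S (fm.get i))) = true ↔ _)
          rw [log_W₁_of_famCheckS hθ h3 hS hK hpr (hfam i)]; simp) hS'
    · exact even_card_of_isSquare_valuation (F.fs.base.W₂r hθ h3 hR hpr) W hW0 _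
        (fun i => by
          show ((!decide ((2 : ℤ) ∣ famL₂S (fm.get i))) = true ↔ _)
          rw [log_W₂_of_famCheckS hθ h3 hS hK hpr (hfam i)]; simp) hS'
    · have hk' : k < F.fs.base.chars.length := by omega
      have hch : F.fs.base.chars.getD k ((3 : ℕ), (0 : ℤ), (0 : ℤ)) ∈ F.fs.base.chars := by
        rw [List.getD_eq_getElem?_getD, List.getElem?_eq_getElem hk', Option.getD_some]
        exact List.getElem_mem hk'
      obtain ⟨h2', ψ, hψ⟩ := F.fs.base.exists_psi_of_reg hθ h3 hR hpr hch
      haveI : Fact (F.fs.base.chars.getD k (3, 0, 0)).1.Prime := ⟨F.fs.base.char_prime hpr hch⟩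
      have hSX : IsSquare (∏ i ∈ S', lin hθ (fm.get i).X.1 (fm.get i).X.2.1 (fm.get i).X.2.2) := by
        have e1 : ∀ i ∈ S', lin hθ (fm.get i).X.1 (fm.get i).X.2.1 (fm.get i).X.2.2 = (F.m₁ : 𝓞 K) * W i :=
          fun i _ => (m₁_mul_eltS hθ (frac_of_famCheckS (hfam i))).symm
        rw [Finset.prod_congr rfl e1, Finset.prod_mul_distrib, Finset.prod_const]
        obtain ⟨z, hz⟩ := hS''
        refine ⟨(F.r₁ : 𝓞 K) ^ S'.card * z, ?_⟩
        rw [hz]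
        simp only [ClFieldCertS2.m₁, Nat.cast_pow]
        ring
      have h := even_card_filter_eulerBit hθ (ℓ := (F.fs.base.chars.getD k (3, 0, 0)).1) (by omega) ψ hψ
        (fun i => (fm.get i).X) (fun i => not_dvd_evalInt_of_famCheckS (hfam i) hch) hSX
      convert h using 2
      exact Finset.filter_congr (fun i _ => Iff.rfl)
  -- spanning of the `T`-units modulo squares
  have hodd : Odd (finrank ℚ K) := by rw [h3]; decide
  have hn : fm.length = NumberField.Units.rank K + 1 + (L + 2) := by
    rw [F.fs.base.units_rank_of_field hθ h3 hfd]
    simp only [hfm, famS, List.length_append, List.length_map, hL, hhead]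
    omega
  have hspan : ∀ u : K, u ≠ 0 →
      (∀ v : HeightOneSpectrum (𝓞 K), eD * ((F.fs.base.q : ℕ) : 𝓞 K) ∉ v.asIdeal → v.valuation K u = 1) →
      ∃ U : Finset (Fin fm.length), IsSquare (u * ∏ j ∈ U, algebraMap (𝓞 K) K (W j)) :=
    fun u hu huT => exists_isSquare_tunit_mul_prod hodd _ Tf hT hn (fun j => algebraMap (𝓞 K) K (W j))
      (fun j => RingOfIntegers.coe_ne_zero_iff.mpr (hW0 j)) hWval hind u hu huT
  -- the sieve is sound at rational points
  have hθQ : ∀ x : ℚ, algebraMap ℚ K x ≠ algebraMap (𝓞 K) K eT :=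
    ne_of_powIndep (powIndep_algebraMap hirrF' haev h3)
  have hFrel : eT ^ 3 + cc.A * eT ^ 2 + cc.B * eT + cc.C = 0 := by
    apply RingOfIntegers.coe_injective
    simpa only [map_add, map_mul, map_pow, map_intCast, _root_.map_zero] using MonicCubic.theta_rel haev
  have hadm0 : admS F cc ∅ ∅ = true := by
    simp only [admS, Bool.and_eq_true, decide_eq_true_eq, Finset.filter_empty, Finset.card_empty]
    exact ⟨⟨admStdQ_empty _ hQ _ _ _ _, by decide⟩, by decide⟩
  have hadm : ∀ x y : ℚ, y ^ 2 = x ^ 3 + cc.A * x ^ 2 + cc.B * x + cc.C →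
      ∀ (T : Finset (Fin 0)) (U : Finset (Fin fm.length)),
        IsSquare ((algebraMap ℚ K x - algebraMap (𝓞 K) K eT) *
          (∏ i ∈ T, algebraMap (𝓞 K) K (((fun i : Fin 0 => i.elim0 : Fin 0 → (𝓞 K)ˣ) i : (𝓞 K)ˣ) : 𝓞 K)) *
            ∏ j ∈ U, algebraMap (𝓞 K) K (W j)) → admS F cc T U = true := by
    intro x y hxy T U hsq
    have hcof := cofactor_pos_of_disc_neg (rho_theta_root ρ haev) hdisc
    have h1 : admStd (fun i : Fin 0 => i.elim0) (famNormS F cc) (fun i : Fin 0 => i.elim0) (famSignS cc) T U =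
        true :=
      admStd_sound hirrF' haev h3 ρ hcof (w := fun i : Fin 0 => algebraMap (𝓞 K) K
          (((fun i : Fin 0 => i.elim0 : Fin 0 → (𝓞 K)ˣ) i : (𝓞 K)ˣ) : 𝓞 K))
        (g := fun j => algebraMap (𝓞 K) K (W j)) (fun i => i.elim0)
        (fun j => RingOfIntegers.coe_ne_zero_iff.mpr (hW0 j)) (fun i => i.elim0)
        (fun j => norm_eltS hθ h3 hS hK (frac_of_famCheckS (hfam j)) (dvd_of_famCheckS (hfam j)))
        (fun i => i.elim0)
        (fun j => sign_iff_of_famCheckS hθ ρ hlo hhi h0 hK (hfam j)) x y hxy T U hsq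
    have h2'' := valRow_sound hFrel hθQ (F.fs.base.W₁r hθ h3 hR hpr) (by rw [hderiv]; exact hDW₁) hW0
      (r := fun j => bitRowS F.fs.base (fm.get j) 1) (fun j => by
        show ((!decide ((2 : ℤ) ∣ famL₁S (fm.get j))) = true ↔ _)
        rw [show algebraMap (𝓞 K) K (W j) = ((W j : 𝓞 K) : K) from rfl,
          log_W₁_of_famCheckS hθ h3 hS hK hpr (hfam j)]; simp) x y hxy T U hsq
    have h3'' := valRow_sound hFrel hθQ (F.fs.base.W₂r hθ h3 hR hpr) (by rw [hderiv]; exact hDW₂) hW0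
      (r := fun j => bitRowS F.fs.base (fm.get j) 2) (fun j => by
        show ((!decide ((2 : ℤ) ∣ famL₂S (fm.get j))) = true ↔ _)
        rw [show algebraMap (𝓞 K) K (W j) = ((W j : 𝓞 K) : K) from rfl,
          log_W₂_of_famCheckS hθ h3 hS hK hpr (hfam j)]; simp) x y hxy T U hsq
    simp only [admS, Bool.and_eq_true]
    exact ⟨⟨admStdQ_of_admStd hQ h1, h2''⟩, h3''⟩
  -- the killed classes: rescale by the square `m₁ ^ (#U + 1) = (r₁ ^ (#U + 1))²`, then `admKills_sound` on
  -- `(m₁ x − X_t(θ)) · ∏_{j ∈ U} X_j(θ)` over the `X`-coordinates of the family (no separate units)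
  have hkill := killListCheck_of_searchS hlite hk
  have hadmK : ∀ x y : ℚ, y ^ 2 = x ^ 3 + cc.A * x ^ 2 + cc.B * x + cc.C →
      ∀ (T : Finset (Fin 0)) (U : Finset (Fin fm.length)),
        IsSquare ((algebraMap ℚ K x - algebraMap (𝓞 K) K eT) *
          (∏ i ∈ T, algebraMap (𝓞 K) K (((fun i : Fin 0 => i.elim0 : Fin 0 → (𝓞 K)ˣ) i : (𝓞 K)ˣ) : 𝓞 K)) *
            ∏ j ∈ U, algebraMap (𝓞 K) K (W j)) → admSK F cc ks T U = true := by
    intro x y hxy T U hsq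
    have hsq' : IsSquare ((algebraMap ℚ K ((F.m₁ : ℚ) * x) -
        algebraMap (𝓞 K) K (lin hθ cc.Xt.1 cc.Xt.2.1 cc.Xt.2.2)) *
          (∏ i ∈ T, algebraMap (𝓞 K) K (((fun i : Fin 0 => i.elim0 : Fin 0 → (𝓞 K)ˣ) i : (𝓞 K)ˣ) : 𝓞 K)) *
            ∏ j ∈ U, algebraMap (𝓞 K) K (lin hθ (fm.get j).X.1 (fm.get j).X.2.1 (fm.get j).X.2.2)) := by
      have e0 : algebraMap ℚ K ((F.m₁ : ℚ) * x) - algebraMap (𝓞 K) K (lin hθ cc.Xt.1 cc.Xt.2.1 cc.Xt.2.2) =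
          (F.m₁ : K) * (algebraMap ℚ K x - algebraMap (𝓞 K) K eT) := by
        rw [mul_sub, hXe, map_mul, map_natCast]
      have e1 : ∀ j ∈ U, algebraMap (𝓞 K) K (lin hθ (fm.get j).X.1 (fm.get j).X.2.1 (fm.get j).X.2.2) =
          (F.m₁ : K) * algebraMap (𝓞 K) K (W j) :=
        fun j _ => (m₁_mul_eltS_coe hθ (frac_of_famCheckS (hfam j))).symm
      rw [e0, Finset.prod_congr rfl e1, Finset.prod_mul_distrib, Finset.prod_const]
      obtain ⟨w, hw⟩ := hsq
      have hm : (F.m₁ : K) * (F.m₁ : K) ^ U.card = ((F.r₁ : K) ^ (U.card + 1)) ^ 2 := by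
        rw [← pow_succ', ClFieldCertS2.m₁, Nat.cast_pow, ← pow_mul, ← pow_mul, Nat.mul_comm]
      refine ⟨(F.r₁ : K) ^ (U.card + 1) * w, ?_⟩
      calc (F.m₁ : K) * (algebraMap ℚ K x - algebraMap (𝓞 K) K eT) *
            (∏ i ∈ T, algebraMap (𝓞 K) K (((fun i : Fin 0 => i.elim0 : Fin 0 → (𝓞 K)ˣ) i : (𝓞 K)ˣ) : 𝓞 K)) *
              ((F.m₁ : K) ^ U.card * ∏ j ∈ U, algebraMap (𝓞 K) K (W j))
          = ((F.m₁ : K) * (F.m₁ : K) ^ U.card) *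
              ((algebraMap ℚ K x - algebraMap (𝓞 K) K eT) *
                (∏ i ∈ T, algebraMap (𝓞 K) K
                  (((fun i : Fin 0 => i.elim0 : Fin 0 → (𝓞 K)ˣ) i : (𝓞 K)ˣ) : 𝓞 K)) *
                  ∏ j ∈ U, algebraMap (𝓞 K) K (W j)) := by ring
        _ = ((F.r₁ : K) ^ (U.card + 1)) ^ 2 * (w * w) := by rw [hm, hw]
        _ = (F.r₁ : K) ^ (U.card + 1) * w * ((F.r₁ : K) ^ (U.card + 1) * w) := by ring
    exact admKills_sound hirr hθ h3 cc.Xt.1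
      (u := fun i : Fin 0 => (((fun i : Fin 0 => i.elim0 : Fin 0 → (𝓞 K)ˣ) i : (𝓞 K)ˣ) : 𝓞 K))
      (fun j => lin hθ (fm.get j).X.1 (fm.get j).X.2.1 (fm.get j).X.2.2)
      (cu := unitCoordsS) (cg := famCoordsS cc) (fun i => i.elim0) (fun j => rfl) hkill
      (hadm x y hxy T U hsq) ((F.m₁ : ℚ) * x) hsq'
  exact mordellWeilRank_le_of_coverSet_cl_lt (A := cc.A) (B := cc.B) (C := cc.C)
    (⟨0, cc.A, 0, cc.B, cc.C⟩ : WeierstrassCurve ℚ) rfl rfl rfl rfl rfl hirrF' haev h3 hM0 hgen hDM hW0 hspan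
    (Wu := fun i : Fin 0 => i.elim0) (adm := admSK F cc ks)
    (admKills_empty hadm0 (noTrivial_of_liteS hlite)) hadmK (s' := r) hcount

/-- **`rank E(ℚ) = r`** from the checked split-2 field record, a kill-list-checked split-2 curve record, its
residue searches and the tree's lower bound. [cite: CremonaAlgorithms1997, §3.6] -/
theorem rank_eq_of_checkSK (r : ℕ) (F : ClFieldCertS2)
    (hθ : aeval θ (MonicCubic.poly F.fs.base.a F.fs.base.b F.fs.base.c) = 0) (h3 : finrank ℚ K = 3)
    (h2 : F.check2 = true) (hpr : F.fs.base.primeList.Forall Nat.Prime) (cc : ClCurveCertS) (ks : List ClKillS)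
    (hc : checkSK F cc r ks = true) (hk : killSearchS F cc ks = true)
    (hlow : r ≤ (((⟨0, cc.A, 0, cc.B, cc.C⟩ : WeierstrassCurve ℤ)).map (Int.castRingHom ℚ)).mordellWeilRank) :
    (((⟨0, cc.A, 0, cc.B, cc.C⟩ : WeierstrassCurve ℤ)).map (Int.castRingHom ℚ)).mordellWeilRank = r := by
  have hmap : ((⟨0, cc.A, 0, cc.B, cc.C⟩ : WeierstrassCurve ℤ)).map (Int.castRingHom ℚ) =
      (⟨0, cc.A, 0, cc.B, cc.C⟩ : WeierstrassCurve ℚ) := by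
    ext <;> simp [WeierstrassCurve.map]
  rw [hmap] at hlow ⊢
  exact le_antisymm (rank_le_of_checkSK r F hθ h3 h2 hpr cc ks hc hk) hlow

end Sound

end Summit.BirchSwinnertonDyer.BirchSwinnertonDyer.Rank2Observatory.TwoDescCl

end
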